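import Literature.MathematicalPhysics.QuantumFieldTheory.Balaban1983to89.B11Eq155BlockLog

/-!
# `Balaban1983to89.B11Eq155BlockLogWeighted` — T. Bałaban, *The variational problem and background fields in renormalization group method for lattice gauge
# theories*, Commun. Math. Phys. **102** (1985) 277–309 [Balaban1985Variational]: (155) p. 302 «V₁ = e^{iB} with |B| < 18d²L³Mε₀» RE-CUT for a CONVEX-WEIGHT
# average of logarithms over an ARBITRARY finite family of products of at most `ℓ` near-identity factors — `‖B‖ < 2ℓδ` under the one smallness `ℓδ ≤ 1∕16`

statement-level skeleton of published theorems with citation tags; proofs where landed; nothing here is a claim about the Yang–Mills mass gap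

PDF held: `paper:balaban1985-cmp102-variational-background` (journal page = PDF page + 276); p. 302 = PDF 26 read first-hand by this seat (2026-08-27; cell
`pub-ymgap`, width seat `pub-ymgap-dag-n07-w3` g0, plan g77 W-SEAT-START-LIST v3 § n07 item S3 «(154)–(156) block-log `B` (`B11Eq155BlockLog` instantiate)»,
AUDIT-S3 rows (154)–(155); `--kind proof --supports stmt-QuantumFields-20542 --as helper`, count-neutral).

THE PRINT (p. 302, verbatim): «Ū₁ʲ(x, x′) = exp[−i Σ_{x₁∈B(x)} L^{−d} (1/i) log V″(Γ_{x,x₁})] V″(x, x′) for ⟨x, x′⟩ ∈ Λ′_j, x ∈ Λ′_{j−1}, x′ ∈ Λ′_j, (154) by Eqs.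
(1.31) in [6]. If we denote by V₁ the configuration on the right-hand sides of (154), then V₁ = e^{iB} with |B| < 18d²L³Mε₀, (155) for c₁ sufficiently small».

WHY THIS FILE.  The sibling `B11Eq155BlockLog` (lit-balaban r08) PROVES (155) for the exponent of (154) exactly as displayed: UNIFORM weights `L^{−d}` on a block of
`#B(x) = L^d` sites, ONE contour `Γ_{x,x₁}` per site, of length `≤ dL` — which is also the shape of [4] (42)∕(43) (the tree's `B7Prop2Explicit.bavg ∕ avgIter`, the
averaging of the `ℤᵈ` member of cell `pub-ymgap`'s NODE 00).  The averaging OF RECORD of that cell's finite-torus programme is [Balaban1987RG1] (0.4) (the tree's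
`BlockAveraging.blockAvg expMeanLogSU`): the exponent is an exp-mean-log over a LOOP family `Γ ∪ [x,x′] ∪ (−Γ′) ∪ (−c)` indexed by its own finite set, with its own
weights and loop lengths `> dL` ([Balaban1987RG1] p. 253: «The considerations and results of this, and previous papers, do not depend on any particular averaging
operation used»).  The (155)-type bound is insensitive to all of this: for ANY convex weights `w` (w ≥ 0, Σ w = 1) on ANY finite index, products of at most `ℓ ≥ 2`
factors each of norm `≤ 1` and `δ`-close to `1`, and a last factor `v` with `‖v‖ ≤ 1`, `‖v − 1‖ ≤ δ`, the field `B = (1/i) log(exp[−i Σ_i w_i (1/i) log W_i]·v)`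
satisfies `‖B‖ < 2ℓδ` and `e^{iB} = exp[…]·v` as soon as `ℓδ ≤ 1∕16` — r08's chain VERBATIM with the block cardinality replaced by convexity and `dL` by `ℓ`; at print's
letters `ℓ = dL`, `δ = 9dL²Mε₀ − ε₀` this is `< 18d²L³Mε₀` again, for every convex weight.

CONTENTS (theorems only, no `def`; r08's `ilog`, `norm_ilog_le`, `exp_I_smul_ilog`, `B11V0Interface.norm_list_prod_sub_one_le_mul` BY NAME).
`norm_wsum_smul_le` · `arith155_weighted` · ★ `norm_ilog_wavg_lt` · `norm_ilog_wavg_lt_printed`.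

HONEST SCOPE.  Banach-algebra bookkeeping around r08's certified logarithmic series; the near-identity hypotheses on the factors ((151)-type) are INPUTS; nothing of
[15] at the cell's objects is typed here; (154)'s identification with an averaging is NOT made; count-neutral; NOT continuum ∕ ℝ⁴ ∕ OS ∕ mass gap ∕ Clay.  No `sorry`.
-/

noncomputable section

open Complex NormedSpace

namespace Literature.MathematicalPhysics.QuantumFieldTheory.Balaban1983to89.B11Eq155BlockLogWeighted

open Literature.MathematicalPhysics.QuantumFieldTheory.Balaban1983to89.B11Eq155BlockLog (ilog norm_ilog_le exp_I_smul_ilog)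
open Literature.MathematicalPhysics.QuantumFieldTheory.Balaban1983to89.B11V0Interface (norm_list_prod_sub_one_le_mul)

variable {𝔄 : Type*} [NormedRing 𝔄] [NormedAlgebra ℂ 𝔄]

/-- A CONVEX-WEIGHT combination of terms of norm `≤ α` has norm `≤ α` (`w ≥ 0`, `Σ w = 1`; real weights read in `ℂ`). [cite: Balaban1985Variational, (154) p.302 (the weights `L^{−d}` of the exponent; bookkeeping)] -/
theorem norm_wsum_smul_le {β : Type*} [Fintype β] {w : β → ℝ} (hw0 : ∀ i, 0 ≤ w i) (hw1 : ∑ i, w i = 1)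
    {X : β → 𝔄} {α : ℝ} (h : ∀ i, ‖X i‖ ≤ α) : ‖∑ i, ((w i : ℝ) : ℂ) • X i‖ ≤ α := by
  calc ‖∑ i, ((w i : ℝ) : ℂ) • X i‖ ≤ ∑ i, ‖((w i : ℝ) : ℂ) • X i‖ := norm_sum_le _ _
    _ = ∑ i, w i * ‖X i‖ := by
        refine Finset.sum_congr rfl fun i _ => ?_
        rw [norm_smul, Complex.norm_real, Real.norm_eq_abs, abs_of_nonneg (hw0 i)]
    _ ≤ ∑ i, w i * α := Finset.sum_le_sum fun i _ => mul_le_mul_of_nonneg_left (h i) (hw0 i)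
    _ = α := by rw [← Finset.sum_mul, hw1, one_mul]

/-- The real arithmetic of the chain with a generic length `ℓ ≥ 2` and closeness `δ > 0` under `ℓδ ≤ 1∕16`: with `t = ℓδ`, `α = (16∕15)t` (bound on the exponent) and
`b = α + α² + δ` (bound on `|V₁ − 1|`): `b ≤ 1∕8` and `(8∕7)·b < 2ℓδ`. [cite: Balaban1985Variational, (155) p.302 (bookkeeping)] -/
theorem arith155_weighted {ℓ δ : ℝ} (hℓ : 2 ≤ ℓ) (hδ : 0 < δ) (hsmall : ℓ * δ ≤ 1 / 16) :
    (16 / 15 * (ℓ * δ) + (16 / 15 * (ℓ * δ)) ^ 2 + δ ≤ 1 / 8) ∧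
    (8 / 7 * (16 / 15 * (ℓ * δ) + (16 / 15 * (ℓ * δ)) ^ 2 + δ) < 2 * ℓ * δ) := by
  have ht0 : 0 < ℓ * δ := mul_pos (by linarith) hδ
  have hδt : 2 * δ ≤ ℓ * δ := by nlinarith
  have hα : 16 / 15 * (ℓ * δ) ≤ 1 / 15 := by linarith
  have hα2 : (16 / 15 * (ℓ * δ)) ^ 2 ≤ (1 / 15) * (16 / 15 * (ℓ * δ)) := by nlinarith
  constructor
  · nlinarith
  · nlinarith

/-- ★ **(155) FOR A CONVEX-WEIGHT AVERAGE OF LOGARITHMS** — for any finite index `β`, convex weights `w` (`w ≥ 0`, `Σ w = 1`), families `Γ i` of AT MOST `ℓ` factors (`ℓ ≥ 2`)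
each of norm `≤ 1` and within `δ` of `1` (`δ > 0`), a last factor `v` with `‖v‖ ≤ 1`, `‖v − 1‖ ≤ δ`, and the smallness `ℓδ ≤ 1∕16`: the field `B := (1/i) log(exp[−i Σ_i w_i
(1/i) log(Π Γ i)]·v)` satisfies `‖B‖ < 2ℓδ`, and `e^{iB} = exp[−i Σ_i w_i (1/i) log(Π Γ i)]·v` («V₁ = e^{iB}»).  The chain: `‖Π Γ i − 1‖ ≤ ℓδ ≤ 1∕16` (telescoping),
`‖(1/i) log Π Γ i‖ ≤ (16∕15)ℓδ =: α`, the exponent has norm `≤ α` (convexity), `‖exp(−i·) − 1‖ ≤ e^α − 1 ≤ α + α²`, `‖V₁ − 1‖ ≤ α + α² + δ ≤ 1∕8`, `‖B‖ ≤ (8∕7)‖V₁ − 1‖ <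
2ℓδ`. [cite: Balaban1985Variational, (155) p.302] -/
theorem norm_ilog_wavg_lt [CompleteSpace 𝔄] {β : Type*} [Fintype β] {w : β → ℝ} (hw0 : ∀ i, 0 ≤ w i) (hw1 : ∑ i, w i = 1)
    {ℓ δ : ℝ} (hℓ : 2 ≤ ℓ) (hδ : 0 < δ) (hsmall : ℓ * δ ≤ 1 / 16)
    (Γ : β → List 𝔄) (h1 : ∀ i, ∀ a ∈ Γ i, ‖a‖ ≤ 1) (hδΓ : ∀ i, ∀ a ∈ Γ i, ‖a - 1‖ ≤ δ) (hlen : ∀ i, ((Γ i).length : ℝ) ≤ ℓ)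
    {v : 𝔄} (hv1 : ‖v‖ ≤ 1) (hvδ : ‖v - 1‖ ≤ δ) :
    ‖ilog (exp (-(I • ∑ i, ((w i : ℝ) : ℂ) • ilog ((Γ i).prod))) * v)‖ < 2 * ℓ * δ ∧
      exp (I • ilog (exp (-(I • ∑ i, ((w i : ℝ) : ℂ) • ilog ((Γ i).prod))) * v)) =
        exp (-(I • ∑ i, ((w i : ℝ) : ℂ) • ilog ((Γ i).prod))) * v := by
  obtain ⟨hb, hfinal⟩ := arith155_weighted hℓ hδ hsmall
  have ht0 : 0 ≤ ℓ * δ := mul_nonneg (by linarith) hδ.le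
  -- the products
  have hW : ∀ i, ‖(Γ i).prod - 1‖ ≤ ℓ * δ := fun i =>
    (norm_list_prod_sub_one_le_mul (Γ i) δ (h1 i) (hδΓ i)).trans (mul_le_mul_of_nonneg_right (hlen i) hδ.le)
  -- their logarithms
  have hα : ∀ i, ‖ilog ((Γ i).prod)‖ ≤ 16 / 15 * (ℓ * δ) := by
    intro i
    have hlt : ‖(Γ i).prod - 1‖ < 1 := (hW i).trans_lt (by linarith)
    refine (norm_ilog_le hlt).trans ?_
    rw [div_le_iff₀ (by linarith)]
    nlinarith [hW i, norm_nonneg ((Γ i).prod - 1)]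
  -- the exponent
  set X := ∑ i, ((w i : ℝ) : ℂ) • ilog ((Γ i).prod) with hXdef
  have hX : ‖X‖ ≤ 16 / 15 * (ℓ * δ) := norm_wsum_smul_le hw0 hw1 hα
  have hX1 : ‖X‖ ≤ 1 := hX.trans (by linarith)
  -- the exponential factor
  have hE : ‖exp (-(I • X)) - 1‖ ≤ 16 / 15 * (ℓ * δ) + (16 / 15 * (ℓ * δ)) ^ 2 := by
    have hn : ‖-(I • X)‖ = ‖X‖ := by rw [norm_neg, norm_smul, Complex.norm_I, one_mul]
    have e1 : ‖exp (-(I • X)) - 1‖ ≤ Real.exp ‖X‖ - 1 := by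
      have := Literature.Analysis.Calculus.norm_exp_sub_one_le (-(I • X)); rwa [hn] at this
    have e2 : Real.exp ‖X‖ - 1 ≤ ‖X‖ + ‖X‖ ^ 2 := by
      have habs : |‖X‖| ≤ 1 := by rw [abs_of_nonneg (norm_nonneg _)]; exact hX1
      have := Real.abs_exp_sub_one_sub_id_le habs
      have := (abs_le.mp this).2
      linarith
    have e3 : ‖X‖ + ‖X‖ ^ 2 ≤ 16 / 15 * (ℓ * δ) + (16 / 15 * (ℓ * δ)) ^ 2 := by
      nlinarith [hX, norm_nonneg X]
    linarith
  -- V₁ − 1 = (E − 1)v + (v − 1)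
  have hV : ‖exp (-(I • X)) * v - 1‖ ≤ 16 / 15 * (ℓ * δ) + (16 / 15 * (ℓ * δ)) ^ 2 + δ := by
    have e : exp (-(I • X)) * v - 1 = (exp (-(I • X)) - 1) * v + (v - 1) := by noncomm_ring
    rw [e]
    calc ‖(exp (-(I • X)) - 1) * v + (v - 1)‖ ≤ ‖exp (-(I • X)) - 1‖ * ‖v‖ + ‖v - 1‖ :=
          norm_add_le_of_le (norm_mul_le _ _) le_rfl
      _ ≤ (16 / 15 * (ℓ * δ) + (16 / 15 * (ℓ * δ)) ^ 2) * 1 + δ := by gcongr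
      _ = 16 / 15 * (ℓ * δ) + (16 / 15 * (ℓ * δ)) ^ 2 + δ := by ring
  have hVlt : ‖exp (-(I • X)) * v - 1‖ < 1 := hV.trans_lt (hb.trans_lt (by norm_num))
  refine ⟨?_, exp_I_smul_ilog hVlt⟩
  -- B = (1/i) log V₁
  have hB : ‖ilog (exp (-(I • X)) * v)‖ ≤ 8 / 7 * (16 / 15 * (ℓ * δ) + (16 / 15 * (ℓ * δ)) ^ 2 + δ) := by
    refine (norm_ilog_le hVlt).trans ?_
    rw [div_le_iff₀ (by linarith)]
    nlinarith [hV, hb, norm_nonneg (exp (-(I • X)) * v - 1)]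
  exact hB.trans_lt hfinal

/-- **(155) WITH PRINT's LETTERS, for every convex weight**: `ℓ = dL` (contours of at most `dL` bonds), `δ = 9dL²Mε₀ − ε₀` ((151)), `d ≥ 1`, `L ≥ 2`, `M ≥ 1`, `ε₀ > 0` and
r08's explicit smallness `9d²L³Mε₀ ≤ 1∕16`: `‖B‖ < 18d²L³Mε₀` and `e^{iB} = V₁` — r08's `ineq155` constant, without the block-cardinality hypothesis.
[cite: Balaban1985Variational, (155) p.302, (151) p.301] -/
theorem norm_ilog_wavg_lt_printed [CompleteSpace 𝔄] {β : Type*} [Fintype β] {w : β → ℝ} (hw0 : ∀ i, 0 ≤ w i) (hw1 : ∑ i, w i = 1)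
    {d L : ℕ} {M ε₀ : ℝ} (hd : 1 ≤ d) (hL : 2 ≤ L) (hM : 1 ≤ M) (hε₀ : 0 < ε₀) (hsmall : 9 * (d : ℝ) ^ 2 * L ^ 3 * M * ε₀ ≤ 1 / 16)
    (Γ : β → List 𝔄) (h1 : ∀ i, ∀ a ∈ Γ i, ‖a‖ ≤ 1) (hδΓ : ∀ i, ∀ a ∈ Γ i, ‖a - 1‖ ≤ 9 * d * L ^ 2 * M * ε₀ - ε₀)
    (hlen : ∀ i, ((Γ i).length : ℝ) ≤ d * L) {v : 𝔄} (hv1 : ‖v‖ ≤ 1) (hvδ : ‖v - 1‖ ≤ 9 * d * L ^ 2 * M * ε₀ - ε₀) :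
    ‖ilog (exp (-(I • ∑ i, ((w i : ℝ) : ℂ) • ilog ((Γ i).prod))) * v)‖ < 18 * (d : ℝ) ^ 2 * L ^ 3 * M * ε₀ ∧
      exp (I • ilog (exp (-(I • ∑ i, ((w i : ℝ) : ℂ) • ilog ((Γ i).prod))) * v)) =
        exp (-(I • ∑ i, ((w i : ℝ) : ℂ) • ilog ((Γ i).prod))) * v := by
  have hdr : (1 : ℝ) ≤ d := by exact_mod_cast hd
  have hLr : (2 : ℝ) ≤ L := by exact_mod_cast hL
  have hℓ : (2 : ℝ) ≤ (d : ℝ) * L := by nlinarith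
  -- δ = 9dL²Mε₀ − ε₀ is positive: 9dL²M ≥ 36 > 1
  have hL2 : (4 : ℝ) ≤ (L : ℝ) ^ 2 := by nlinarith
  have hdl : (4 : ℝ) ≤ d * (L : ℝ) ^ 2 := by nlinarith [mul_nonneg (sub_nonneg.2 hdr) (sub_nonneg.2 hL2)]
  have hdlm : (4 : ℝ) ≤ d * (L : ℝ) ^ 2 * M := by nlinarith [mul_nonneg (sub_nonneg.2 hdl) (sub_nonneg.2 hM)]
  have hδ : 0 < 9 * (d : ℝ) * L ^ 2 * M * ε₀ - ε₀ := by nlinarith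
  -- ℓδ ≤ dL·9dL²Mε₀ = 9d²L³Mε₀ ≤ 1/16
  have hsm : (d : ℝ) * L * (9 * (d : ℝ) * L ^ 2 * M * ε₀ - ε₀) ≤ 1 / 16 := by
    have hdL0 : (0 : ℝ) ≤ (d : ℝ) * L := by positivity
    have : (d : ℝ) * L * (9 * (d : ℝ) * L ^ 2 * M * ε₀ - ε₀) ≤ (d : ℝ) * L * (9 * (d : ℝ) * L ^ 2 * M * ε₀) :=
      mul_le_mul_of_nonneg_left (by linarith) hdL0
    have h2 : (d : ℝ) * L * (9 * (d : ℝ) * L ^ 2 * M * ε₀) = 9 * (d : ℝ) ^ 2 * L ^ 3 * M * ε₀ := by ring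
    linarith
  obtain ⟨hlt, hexp⟩ := norm_ilog_wavg_lt hw0 hw1 hℓ hδ hsm Γ h1 hδΓ hlen hv1 hvδ
  refine ⟨hlt.trans_le ?_, hexp⟩
  have hdL0 : (0 : ℝ) ≤ (d : ℝ) * L := by positivity
  calc 2 * ((d : ℝ) * L) * (9 * (d : ℝ) * L ^ 2 * M * ε₀ - ε₀) ≤ 2 * ((d : ℝ) * L) * (9 * (d : ℝ) * L ^ 2 * M * ε₀) :=
        mul_le_mul_of_nonneg_left (by linarith) (by positivity)
    _ = 18 * (d : ℝ) ^ 2 * L ^ 3 * M * ε₀ := by ring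

end Literature.MathematicalPhysics.QuantumFieldTheory.Balaban1983to89.B11Eq155BlockLogWeighted

end
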